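import Mathlib
import Summits.Ventures.HodgeRepro.Tier4.Line1.RTFSetting
import Summits.Ventures.HodgeRepro.Tier4.Line1.RelClosedOrtho
import Summits.Ventures.HodgeRepro.Tier4.Line1.MaximalFamily
import Summits.Ventures.HodgeRepro.Tier4.Line1.HeckeFiniteness
import Summits.Ventures.HodgeRepro.Tier4.Line1.HeckeIsolation
import Summits.Ventures.HodgeRepro.Tier4.Line1.JacobsonBlock

/-!
# Tier4/Line1/HeckeRankOneOfBlock — the bridge of (S3a): `HeckeRankOne` DERIVED from (C1) + (C2) on a displayed finite
Hecke block with its level idempotent (module 3 of the self-pointed cut S13690 / S13715 / S13738)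

Blind re-derivation cell `pub-hodge-repro`, Tier 4 (README §9–§10), seat t4-L1-p5 (prover, LINE L1, gen 3).  Target tree
path `lean/Summits/Ventures/HodgeRepro/Tier4/Line1/HeckeRankOneOfBlock.lean`.  Imports this seat's `HeckeIsolation`
(p683711: `HeckeRankOne`, `conj_inner`), t4-L1-p1 g3's `JacobsonBlock` (p684029: `blockAlgebra_realises` — the
pure-algebra rung (C1) ∧ (C2) ⇒ (C3)) and `HeckeFiniteness` (`inner_self_ne_zero_of_invariant`), t4-L1-p4's
`RelClosedOrtho` (`inner_add_left'`, `inner_smul_left'`), t4-L4-p1's `MaximalFamily` (`R_zero`).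

WHAT THIS IS.  `HeckeIsolation` displays the admissibility theory of the L1 residual in its rank-one consequence
`HeckeRankOne S τ m Vfin` and proves (S3a) from it.  `JacobsonBlock` proves that the rank-one consequence follows
from (C1) simplicity and (C2) pairwise non-isomorphism on an ABSTRACT finite block.  This module does the
identification of that abstract block with the RTF objects, with every ingredient DISPLAYED as a field of
`HeckeBlock S τ m H ι Vb`:
* the Hecke algebra `H` (a ℂ-algebra) given through test functions `tst : H → (G → ℂ)` acting by the right-regular
  action `S.R (tst r)`; the finite block `Vb ⊆ (G → ℂ)` (on the instance `⊕_{m' ∈ L} e(τ m')`, `e = e_{K_f} ⋆ e_σ` the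
  idempotent of a level and a finite set of `K_∞`-types) with its `H`-module structure, COMPATIBLE with the action
  (`hact : (r • ψ : Vb) = S.R (tst r) ψ` — the convolution algebra law `R(f ⋆ f') = R(f) R(f')` sits in this module
  structure); the constituents of the block `W i = τ (idx i) ∩ Vb` with their `H`-linear projections `π i` (the
  isotypic projections) and the index `i₀` of the constituent `τ m` of interest;
* (C1) `simple : ∀ i, IsSimpleModule H (W i)` and (C2) `hnon : ∀ i ≠ j, IsEmpty (W i ≃ₗ[H] W j)` — DISPLAYED, never
  proved (on the instance: admissibility of the irreducible constituents and multiplicity one — PRINT);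
* the level idempotent `e` with its three identities: every Hecke element factors through it (`he_R`), it maps each
  constituent into the block and the constituent (`he_mem`), it is self-adjoint for the `L²(D_G)` pairing (`he_adj`)
  and the identity on the block (`he_id`).
THE THEOREM `heckeRankOne_of_block`: for every `D : HeckeBlock S τ m H ι Vb`, `HeckeRankOne S τ m (blockAdmissible τ m Vb)` holds with
`blockAdmissible τ m Vb = τ m ∩ Vb` — so, composed with `HeckeIsolation.exists_isolatedAt_of_heckeRankOne`, (S3a) is a kernel
theorem modulo (C1), (C2), the block data and the idempotent identities (`exists_isolatedAt_of_heckeBlock`).  Proof: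
Jacobson density (`blockAlgebra_realises`) on the block-diagonal family «`x ↦ ⟪x, v⟫ w` on `W i₀`, `0` on the other
constituents» gives `r ∈ H`; `f := tst r` is a test function; for `ψ ∈ τ m'`, `R(f) ψ = R(f)(e ψ)` with `e ψ` in the
block: if `m'` is a constituent of the block other than `m` the block-diagonal action kills it, if `m'` is not in the
block then `e ψ` is orthogonal to every constituent of the block and hence zero (`orthSub` + positivity), and for
`m' = m` the action is `⟪e ψ, v⟫ w = ⟪ψ, v⟫ w` (`e` self-adjoint, identity on the block).
Honesty: nothing of (C1), (C2), the convolution law, the finiteness of the level set or the idempotent identities is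
proved — they are the fields of `HeckeBlock`; no instance of `HeckeBlock` is constructed (on the intended instance
the fields are (A)+(C1)+(C2) plus Fubini-level identities of the level projector).  Nothing here says anything about
the status of the Hodge conjecture for CM abelian varieties, which is NOT proved (HC_CM is NOT proved by anyone in
this repository).
-/

set_option autoImplicit false

noncomputable section

namespace Summit.Ventures.HodgeRepro.Tier4.Line1

open MeasureTheory Topology

namespace RTF

namespace Setting

variable {G : Type} [Group G] [TopologicalSpace G] [IsTopologicalGroup G] [MeasurableSpace G] [BorelSpace G]
  (S : Setting G)

/-- **A FINITE HECKE BLOCK OF THE SPECTRUM WITH ITS LEVEL IDEMPOTENT, DISPLAYED** (the identification of the abstract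
block of `JacobsonBlock` with the RTF objects): the Hecke algebra `H` through test functions `tst`, the finite block
`Vb` with its compatible `H`-module structure, its constituents `W i = τ (idx i) ∩ Vb` with projections `π i`, the
index `i₀` of `τ m`, (C1) simplicity, (C2) pairwise non-isomorphism, and the idempotent `e` with its identities.
Every field is a HYPOTHESIS of the theorems below; no instance is constructed here. -/
structure HeckeBlock (τ : ℕ → Set (G → ℂ)) (m : ℕ) (H : Type) [Ring H] [Algebra ℂ H] (ι : Type) [Fintype ι]
    [DecidableEq ι] (Vb : Submodule ℂ (G → ℂ)) [FiniteDimensional ℂ Vb] [Module H Vb] [IsScalarTower ℂ H Vb] where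
  /-- the Hecke elements as test functions -/
  tst : H → (G → ℂ)
  /-- every Hecke element is a test function -/
  htst : ∀ r, IsTest (tst r)
  /-- the `H`-action on the block IS the right-regular action of the test functions (the convolution law) -/
  hact : ∀ (r : H) (ψ : Vb), ((r • ψ : Vb) : G → ℂ) = S.R (tst r) ψ
  /-- the constituents of the block, by index -/
  idx : ι → ℕ
  /-- the index of `τ m` -/
  i₀ : ι
  /-- `τ m` is the `i₀`-th constituent -/
  hi₀ : idx i₀ = m
  /-- the constituents as `H`-submodules of the block -/
  W : ι → Submodule H Vb
  /-- `W i = τ (idx i) ∩ Vb` -/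
  hW : ∀ (i : ι) (ψ : Vb), ψ ∈ W i ↔ (ψ : G → ℂ) ∈ τ (idx i)
  /-- the `H`-linear projections onto the constituents -/
  π : ι → Vb →ₗ[H] Vb
  /-- `π i` lands in `W i` -/
  hπmem : ∀ i v, π i v ∈ W i
  /-- the projections sum to the identity -/
  hπsum : ∀ v, ∑ i, π i v = v
  /-- `π i` is the identity on `W i` -/
  hπid : ∀ i, ∀ w ∈ W i, π i w = w
  /-- `π i` kills `W j` for `j ≠ i` -/
  hπzero : ∀ i j, i ≠ j → ∀ w ∈ W j, π i w = 0
  /-- (C1): every constituent of the block is a simple `H`-module -/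
  [simple : ∀ i, IsSimpleModule H (W i)]
  /-- (C2): the constituents are pairwise non-isomorphic `H`-modules -/
  hnon : ∀ i j, i ≠ j → IsEmpty ((W i) ≃ₗ[H] (W j))
  /-- the level idempotent -/
  e : (G → ℂ) → (G → ℂ)
  /-- `e` maps every constituent into the block and into the constituent -/
  he_mem : ∀ m', ∀ ψ ∈ τ m', e ψ ∈ Vb ∧ e ψ ∈ τ m'
  /-- every Hecke element factors through `e` -/
  he_R : ∀ r ψ, S.R (tst r) ψ = S.R (tst r) (e ψ)
  /-- `e` is self-adjoint for the `L²(D_G)` pairing -/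
  he_adj : ∀ ψ v, S.inner (e ψ) v = S.inner ψ (e v)
  /-- `e` is the identity on the block -/
  he_id : ∀ v ∈ Vb, e v = v

/-- **the admissible vectors of `τ m` for a block `Vb`**: the vectors of `τ m` lying in the block. -/
def blockAdmissible (τ : ℕ → Set (G → ℂ)) (m : ℕ) (Vb : Submodule ℂ (G → ℂ)) : Set (G → ℂ) :=
  {ψ | ψ ∈ Vb ∧ ψ ∈ τ m}

omit [Group G] [TopologicalSpace G] [IsTopologicalGroup G] [MeasurableSpace G] [BorelSpace G] in
/-- the admissible vectors lie in `τ m`. -/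
theorem blockAdmissible_subset (τ : ℕ → Set (G → ℂ)) (m : ℕ) (Vb : Submodule ℂ (G → ℂ)) :
    blockAdmissible τ m Vb ⊆ τ m := fun _ h => h.2

namespace HeckeBlock

variable {S} {τ : ℕ → Set (G → ℂ)} {m : ℕ} {H : Type} [Ring H] [Algebra ℂ H] {ι : Type} [Fintype ι] [DecidableEq ι]
  {Vb : Submodule ℂ (G → ℂ)} [FiniteDimensional ℂ Vb] [Module H Vb] [IsScalarTower ℂ H Vb]
  (D : HeckeBlock S τ m H ι Vb)

omit [IsTopologicalGroup G] [BorelSpace G] in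
/-- a vector of the `i`-th constituent is continuous. -/
theorem continuous_of_mem (hinv : ∀ m', S.IsInvariantSubspace (τ m')) {i : ι} {ψ : Vb} (hψ : ψ ∈ D.W i) :
    Continuous (ψ : G → ℂ) :=
  (hinv (D.idx i)).cont _ ((D.hW i ψ).mp hψ)

omit [IsTopologicalGroup G] in
/-- the pairing against a fixed continuous `v` is a ℂ-linear functional on the `i`-th constituent. -/
def pairing (hinv : ∀ m', S.IsInvariantSubspace (τ m')) {v : G → ℂ} (hv : Continuous v) (i : ι) :
    D.W i →ₗ[ℂ] ℂ where
  toFun x := S.inner (x : G → ℂ) v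
  map_add' x y := by
    have hx := D.continuous_of_mem hinv x.2
    have hy := D.continuous_of_mem hinv y.2
    have h := S.inner_add_left' hx hy hv
    simp only [Submodule.coe_add]
    rw [← h]
    rfl
  map_smul' c x := by
    have hx := D.continuous_of_mem hinv x.2
    have h := S.inner_smul_left' hx hv c
    simp only [RingHom.id_apply, smul_eq_mul]
    rw [Submodule.coe_smul_of_tower, Submodule.coe_smul]
    exact h

omit [IsTopologicalGroup G] in
/-- the functional is the pairing. -/
theorem pairing_apply (hinv : ∀ m', S.IsInvariantSubspace (τ m')) {v : G → ℂ} (hv : Continuous v) (i : ι)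
    (x : D.W i) : D.pairing hinv hv i x = S.inner (x : G → ℂ) v := rfl

omit [IsTopologicalGroup G] [BorelSpace G] in
/-- the target vector of the rank-one family: `w` in the `i₀`-th constituent, `0` in the others. -/
def target {w : G → ℂ} (hw : w ∈ blockAdmissible τ m Vb) (i : ι) : D.W i :=
  if h : i = D.i₀ then ⟨⟨w, hw.1⟩, by rw [h, D.hW, D.hi₀]; exact hw.2⟩ else 0

omit [IsTopologicalGroup G] [BorelSpace G] in
/-- the target vector at `i₀`. -/
theorem target_i₀ {w : G → ℂ} (hw : w ∈ blockAdmissible τ m Vb) : ((D.target hw D.i₀ : Vb) : G → ℂ) = w := by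
  simp only [target, dif_pos]

omit [IsTopologicalGroup G] [BorelSpace G] in
/-- the target vector away from `i₀`. -/
theorem target_ne {w : G → ℂ} (hw : w ∈ blockAdmissible τ m Vb) {i : ι} (hi : i ≠ D.i₀) : D.target hw i = 0 := by
  simp only [target, dif_neg hi]

omit [IsTopologicalGroup G] in
/-- **a vector of a constituent outside the block that lies in the block is zero**: it is orthogonal to every
constituent of the block (`orthSub`), hence to itself, hence zero by positivity. -/
theorem eq_zero_of_mem_block_of_not_idx [Countable S.Gk] [MeasurableMul G] {φ : ℕ → G → ℂ} {n : ℕ → ℕ}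
    (hB : S.IsAdaptedONB τ φ n) {m' : ℕ} (hm' : ∀ i, D.idx i ≠ m') {ψ : G → ℂ} (hψV : ψ ∈ Vb)
    (hψτ : ψ ∈ τ m') : ψ = 0 := by
  classical
  by_contra hne
  have hψc : Continuous ψ := (hB.inv m').cont ψ hψτ
  have hψi : S.Invariant ψ := (hB.inv m').inv ψ hψτ
  apply S.inner_self_ne_zero_of_invariant hψc hψi hne
  -- expand `ψ` along the constituents of the block
  have hsum : (⟨ψ, hψV⟩ : Vb) = ∑ i, D.π i ⟨ψ, hψV⟩ := (D.hπsum _).symm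
  have h := congrArg (fun z : Vb => (z : G → ℂ)) hsum
  simp only [Submodule.coe_sum] at h
  have hfun : (fun x => ∑ i ∈ Finset.univ, (1 : ℂ) * ((D.π i ⟨ψ, hψV⟩ : Vb) : G → ℂ) x) = ψ := by
    funext x
    simp only [one_mul]
    have hx := congrFun h x
    rw [Finset.sum_apply] at hx
    exact hx.symm
  have hcont : ∀ i ∈ (Finset.univ : Finset ι), Continuous ((D.π i ⟨ψ, hψV⟩ : Vb) : G → ℂ) := fun i _ =>
    D.continuous_of_mem hB.inv (D.hπmem i _)
  calc S.inner ψ ψ = S.inner (fun x => ∑ i ∈ Finset.univ, (1 : ℂ) * ((D.π i ⟨ψ, hψV⟩ : Vb) : G → ℂ) x) ψ := by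
        rw [hfun]
    _ = ∑ i ∈ Finset.univ, (1 : ℂ) * S.inner ((D.π i ⟨ψ, hψV⟩ : Vb) : G → ℂ) ψ :=
        S.inner_finset_sum_left ψ hψc Finset.univ (fun _ => (1 : ℂ)) _ hcont
    _ = 0 := by
        refine Finset.sum_eq_zero fun i _ => ?_
        have hmem : ((D.π i ⟨ψ, hψV⟩ : Vb) : G → ℂ) ∈ τ (D.idx i) := (D.hW i _).mp (D.hπmem i _)
        rw [hB.orthSub (D.idx i) m' (hm' i) _ hmem ψ hψτ, mul_zero]

omit [IsTopologicalGroup G] in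
include D in
/-- **THE BRIDGE: `HeckeRankOne` from (C1) + (C2) on the displayed block** — Jacobson density on the block-diagonal
family «`⟪·, v⟫ w` on `W i₀`, `0` elsewhere» gives a Hecke element whose test function kills every other constituent
and acts on `τ m` as the rank-one operator `⟪·, v⟫ w`. -/
theorem heckeRankOne [Countable S.Gk] [MeasurableMul G] {φ : ℕ → G → ℂ} {n : ℕ → ℕ}
    (hB : S.IsAdaptedONB τ φ n) : HeckeRankOne S τ m (blockAdmissible τ m Vb) := by
  classical
  haveI := D.simple
  intro v hv w hw
  have hvc : Continuous v := (hB.inv m).cont v hv.2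
  -- the block-diagonal family
  let T : ∀ i, Module.End ℂ (D.W i) := fun i => (D.pairing hB.inv hvc i).smulRight (D.target hw i)
  obtain ⟨r, hr⟩ := JacobsonBlock.blockAlgebra_realises D.W D.π D.hπmem D.hπsum D.hπid D.hπzero D.hnon T
  refine ⟨D.tst r, D.htst r, ?_, ?_⟩
  · -- the other constituents are killed
    intro m' hm' ψ hψ
    obtain ⟨heV, heτ⟩ := D.he_mem m' ψ hψ
    rw [D.he_R]
    by_cases hidx : ∃ i, D.idx i = m'
    · obtain ⟨i, hi⟩ := hidx
      have hi₀ : i ≠ D.i₀ := by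
        intro h
        apply hm'
        rw [← hi, h, D.hi₀]
      have hmem : (⟨D.e ψ, heV⟩ : Vb) ∈ D.W i := by
        rw [D.hW, hi]
        exact heτ
      have h1 := hr i _ hmem
      have h2 : (T i ⟨⟨D.e ψ, heV⟩, hmem⟩ : Vb) = 0 := by
        simp only [T, LinearMap.smulRight_apply, D.target_ne hw hi₀, smul_zero, Submodule.coe_zero]
      rw [h2] at h1
      have h3 := D.hact r ⟨D.e ψ, heV⟩
      rw [h1] at h3
      funext x
      have := congrFun h3 x
      simpa using this.symm
    · have hidx' : ∀ i, D.idx i ≠ m' := fun i h => hidx ⟨i, h⟩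
      have h0 : D.e ψ = 0 := D.eq_zero_of_mem_block_of_not_idx hB hidx' heV heτ
      rw [h0, S.R_zero]
      rfl
  · -- the rank-one action on `τ m`
    intro ψ hψ
    obtain ⟨heV, heτ⟩ := D.he_mem m ψ hψ
    rw [D.he_R]
    have hmem : (⟨D.e ψ, heV⟩ : Vb) ∈ D.W D.i₀ := by
      rw [D.hW, D.hi₀]
      exact heτ
    have h1 := hr D.i₀ _ hmem
    have h2 : (T D.i₀ ⟨⟨D.e ψ, heV⟩, hmem⟩ : Vb) = S.inner (D.e ψ) v • (⟨w, hw.1⟩ : Vb) := by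
      simp only [T, LinearMap.smulRight_apply]
      rw [Submodule.coe_smul_of_tower]
      have ht : (D.target hw D.i₀ : Vb) = ⟨w, hw.1⟩ := by
        simp only [target, dif_pos]
      rw [ht]
      rfl
    rw [h2] at h1
    have h3 := D.hact r ⟨D.e ψ, heV⟩
    rw [h1] at h3
    have h4 : S.inner (D.e ψ) v = S.inner ψ v := by
      rw [D.he_adj, D.he_id v hv.1]
    funext x
    have := congrFun h3 x
    simp only [Submodule.coe_smul, Pi.smul_apply, smul_eq_mul] at this
    rw [← this, h4]

end HeckeBlock

/-- **(S3a) from a displayed Hecke block**: the composition of `heckeRankOne_of_block` with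
`exists_isolatedAt_of_heckeRankOne` — an isolating test pair for `τ m` from (C1), (C2), the block data, the idempotent
identities and the two toric periods on the admissible vectors. -/
theorem exists_isolatedAt_of_heckeBlock [Countable S.Gk] [MeasurableMul G] {χ : S.T → ℂ} {χ' : S.T' → ℂ}
    {τ : ℕ → Set (G → ℂ)} {φ : ℕ → G → ℂ} {n : ℕ → ℕ} (hB : S.IsAdaptedONB τ φ n) {m : ℕ} {H : Type} [Ring H]
    [Algebra ℂ H] {ι : Type} [Fintype ι] [DecidableEq ι] {Vb : Submodule ℂ (G → ℂ)} [FiniteDimensional ℂ Vb]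
    [Module H Vb] [IsScalarTower ℂ H Vb] (D : HeckeBlock S τ m H ι Vb)
    (hT : ∃ w ∈ blockAdmissible τ m Vb, S.periodT χ (fun t => w t) ≠ 0)
    (hT' : ∃ w' ∈ blockAdmissible τ m Vb, S.periodT' χ' (fun t' => w' t') ≠ 0) :
    ∃ f₁ f₂ : G → ℂ, IsTest f₁ ∧ IsTest f₂ ∧ IsolatedAt S χ χ' φ n f₁ f₂ m :=
  exists_isolatedAt_of_heckeRankOne hB (blockAdmissible_subset τ m Vb) (D.heckeRankOne hB) hT hT'

end Setting

end RTF

end Summit.Ventures.HodgeRepro.Tier4.Line1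

end
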